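import Literature.Probability.RandomPlanarGeometry.HexSAWStripSurfaceBridgeNull
import Literature.Probability.RandomPlanarGeometry.HexSAWStripSurfaceMonotone
import HarnessLib

/-!
# The critical arch generating function of a strip AT the critical surface fugacity: `cos(3π/8)·A_T(x_c, y_c) = 1` for every `T`
# — i.e. `A_T(x_c, y_c) = A(x_c)`, the half-plane value, in every finite strip — and the quadratic rate `A_{T+1}(x_c,y) − A_T(x_c,1) = O(B_T(x_c,1)²)` below `y_c`

Door «HEX-CRITICAL-ARCH» of lane pub-sawmu (a-idea-1 gen 23, Part IV of the «YT-RATE» series; lens: bridge / arch decompositions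
with explicit rates).  Beaton–Bousquet-Mélou–de Gier–Duminil-Copin–Guttmann (CMP 326 (2014), arXiv:1109.0358v5) write the
identity (16) `1 = α A_{T,L}(x_c,y) + ε E_{T,L}(x_c,y) + β(y) B_{T,L}(x_c,y)` and note (§4.2, v5 p. 14, verbatim) «Since the
coefficients α and ε are positive, the above identity shows that A_{T,L}(x_c; y*) remains bounded as L increases. Hence the
limit lim_{L→∞} A_{T,L}(x_c; y*) exists and is finite»; Proposition 9 (18) (p. 14) is `α A_T(x_c,y) + β(y) B_T(x_c,y) = 1` for
`0 ≤ y < y_T`.  Since `β(y*) = 0` and (Theorem 2, Corollary 8) `y* = y_c < y_T`, (18) AT `y = y_c` reads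

  **`cos(3π/8) · A_T(x_c, y_c) = 1` for every `T ≥ 1`** — the value `1/cos(3π/8) = A(x_c)` of the HALF-PLANE arch series
  (`lim_T A_T(x_c,1) = 1/α`, Theorem 10 with (19); tree `tendsto_stripAlim`) is attained EXACTLY in every finite strip once the
  far wall carries the critical surface weight.  This statement IS PRINTED: Beaton–Guttmann–Jensen 2012 (adsorption paper), §2
  eq. (4) «1 = cos(3π/8) A_T(x_c, y_c)», derived there from the BBdGDCG identity with `E_T(x_c,y) = 0` (`y ≤ y_c`) and `y_c = y*`,
  and called «a remarkable equation in that it implies that y_c can be identified from … A_T(x_c,y) for any width T»; the file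
  CONSOLIDATES it by a different route (Proposition 9 at `y = y_c`, legitimate because `y_c < y_T`) — no novelty is claimed for it.

This file types that statement over the tree's objects, with the strictness `y_c < y_T` as a HYPOTHESIS (`yStar < stripYT T`;
BBdGDCG Corollary 8, HOME door D «GROWTH-STRICT» of a-p2 — not proved here), and reads it against the sub-critical regime:

* `stripGFy_alpha_yStar_le`, `tendsto_stripAy_yStar`, `cos_mul_stripAyLim_yStar_le_one` — v5 p. 14 as printed: `A_{T,L}(x_c,y*) ≤ 1/α`,
  the limit `A_T(x_c,y*)` exists, `α A_T(x_c,y*) ≤ 1` (unconditional, `T ≥ 1`);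
* ★ `cos_mul_stripAyLim_yStar_eq_one (hT : 1 ≤ T) (h : yStar < stripYT T)` — **`cos(3π/8)·A_T(x_c,y_c) = 1`**; `stripAyLim_yStar_eq`
  (`A_T(x_c,y_c) = 1/cos(3π/8)`), ★ `tendsto_stripAlim_nhds_stripAyLim_yStar` (`A_S(x_c,1) → A_T(x_c,y_c)` as `S → ∞`, every `T`);
* ★ `stripAyLim_succ_yStar_sub_stripAlim (h : yStar < stripYT (T+1))` — the EXACT first-order gap
  **`A_{T+1}(x_c,y_c) − A_T(x_c,1) = B_T(x_c,1)/cos(3π/8)`** (with (19): `α A_T(x_c,1) + B_T(x_c,1) = 1`);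
* the sub-critical contrast, sharpening the tree's `abs_stripAyLim_succ_sub_le` (rate `B_T`) by one order:
  `stripAyLim_succ_sub_stripAlim_le_mul` — the arch cut (20) in the limit, `A_{T+1}(x_c,y) − A_T(x_c,1) ≤ x_c·B_T(x_c,1)·B_{T+1}(x_c,y)`,
  and with the one-row sandwich `B_{T+1}(x_c,y) ≤ B_T(x_c,1)/β(y)` ★ `abs_stripAyLim_succ_sub_stripAlim_le_sq`:
  **`|A_{T+1}(x_c,y) − A_T(x_c,1)| ≤ x_c·(√2y/(1+√2−y))·B_T(x_c,1)²`** for `0 < y < y_c` (≤ `x_c(√2y/(1+√2−y))·25(ln T)^{-2/3}` by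
  Glazman–Manolescu, `_le_log_sq`).  So the arch series approaches `A(x_c)` at rate `B_T²` strictly below `y_c` but sits AT `A(x_c)`
  with first-order remainder `B_T/α` relative to `A_T(x_c,1)` exactly at `y_c`.

Objects: `A_T(x_c,y) = stripAyLim T y = ⨆_L A_{T,L}(x_c,y)`, `B_T(x_c,y) = stripByLim T y` (`HexSAWStripSurfaceLimits`),
`A_T(x_c,1) = stripAlim T`, `B_T(x_c,1) = stripBlim T`, `y* = yStar = 1+√2`, `β = betaY`, `y_T = stripYT T`.
Imports: tree only (`HexSAWStripSurfaceBridgeNull`, `HexSAWStripSurfaceMonotone`) ⇒ CLASS S.  No `sorry`, no new axioms.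

References: [BBdGDCG14] arXiv:1109.0358v5 §4.2 (p. 14), Proposition 9 eq. (18) (p. 14), §4.4 Theorem 10 and (19) (p. 14), §4.5 (20)
(p. 15), Theorem 2 (p. 3), Corollary 8 (p. 12); [BGJ12-Ads] N. R. Beaton, A. J. Guttmann, I. Jensen, J. Phys. A 45 (2012)
055208 = arXiv:1110.6695, bib key `BeatonGuttmannJensen2012Adsorption` (the key `BeatonGuttmannJensen2012` is their OTHER 2012 paper,
arXiv:1110.1141), §2 eq. (4) (arXiv PDF p. 4) «1 = cos(3π/8) A_T(x_c, y_c)» and «This is a remarkable equation in that it implies that y_c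
can be identified from the generating function A_T(x_c, y) for any width T» (the printed source of the critical identity); [DCS12] Lemma 2; [GM19] (tree `HexSAWBridgeLogDecay`).
-/

noncomputable section

open Finset Filter Topology

namespace Literature.Probability.RandomPlanarGeometry.SAW.HV

variable {T : ℕ}

/-- `β(y*) = 0`, since `β(y) = (y* − y)/(y(y* − 1))`. [folklore]
[cite: BeatonBousquetMelouDeGierDuminilCopinGuttmann2014, §4.1 (arXiv v5 p. 13: "β(y) = (y*−y)/(y(y*−1)) = (1+√2−y)/(√2 y)")] -/
private theorem betaY_yStar_eq_zero : betaY yStar = 0 := by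
  unfold betaY yStar; simp

/-! ### v5 p. 14 as printed: `A_{T,L}(x_c, y*)` is bounded by `1/α`, so `A_T(x_c, y*)` exists -/

/-- `A_{T,L}(x_c, y*) ≤ 1/cos(3π/8)` for every `T ≥ 1`, `L` (identity (16) at `y = y*`, where `β(y*) = 0`, and `E ≥ 0`).
[cite: BeatonBousquetMelouDeGierDuminilCopinGuttmann2014, §4.2 (arXiv v5 p. 14: "Since the coefficients α and ε are positive, the above identity shows that A_{T,L}(x_c; y*) remains bounded as L increases")] -/
theorem stripGFy_alpha_yStar_le (hT : 1 ≤ T) (L : ℕ) : stripGFy T L IsAlphaDart yStar ≤ 1 / Real.cos (3 * Real.pi / 8) := by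
  have hid := stripIdentityY_holds T L yStar hT yStar_pos
  rw [betaY_yStar_eq_zero, zero_mul, add_zero] at hid
  have hE : 0 ≤ stripGFy T L (IsEpsDart L) yStar := stripGFy_nonneg' T L (IsEpsDart L) yStar_pos.le
  have hc : 0 < Real.cos (3 * Real.pi / 8) := cos_three_pi_div_eight_pos
  have hε : 0 < Real.cos (Real.pi / 4) := cos_pi_div_four_pos'
  rw [le_div_iff₀ hc]
  nlinarith [mul_nonneg hε.le hE]

/-- The range of `L ↦ A_{T,L}(x_c, y*)` is bounded above (`T ≥ 1`). [cite: BeatonBousquetMelouDeGierDuminilCopinGuttmann2014, §4.2 (arXiv v5 p. 14)] -/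
theorem bddAbove_stripGFy_alpha_yStar (hT : 1 ≤ T) : BddAbove (Set.range fun L : ℕ => stripGFy T L IsAlphaDart yStar) :=
  ⟨_, by rintro _ ⟨L, rfl⟩; exact stripGFy_alpha_yStar_le hT L⟩

/-- **`A_{T,L}(x_c, y*) → A_T(x_c, y*)` as `L → ∞`, the limit finite** (`T ≥ 1`; monotone and bounded).
[cite: BeatonBousquetMelouDeGierDuminilCopinGuttmann2014, §4.2 (arXiv v5 p. 14: "Hence the limit lim_{L→∞} A_{T,L}(x_c; y*) exists and is finite")] -/
theorem tendsto_stripAy_yStar (hT : 1 ≤ T) :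
    Tendsto (fun L : ℕ => stripGFy T L IsAlphaDart yStar) atTop (𝓝 (stripAyLim T yStar)) :=
  tendsto_atTop_ciSup (fun _ _ h => stripGFy_alpha_mono_L h yStar_pos.le) (bddAbove_stripGFy_alpha_yStar hT)

/-- `cos(3π/8)·A_T(x_c, y*) ≤ 1`, unconditionally (`T ≥ 1`). [cite: BeatonBousquetMelouDeGierDuminilCopinGuttmann2014, §4.2 (arXiv v5 p. 14)] -/
theorem cos_mul_stripAyLim_yStar_le_one (hT : 1 ≤ T) : Real.cos (3 * Real.pi / 8) * stripAyLim T yStar ≤ 1 := by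
  have hc : 0 < Real.cos (3 * Real.pi / 8) := cos_three_pi_div_eight_pos
  have h : stripAyLim T yStar ≤ 1 / Real.cos (3 * Real.pi / 8) :=
    ciSup_le fun L => stripGFy_alpha_yStar_le hT L
  rw [le_div_iff₀ hc] at h
  linarith [mul_comm (Real.cos (3 * Real.pi / 8)) (stripAyLim T yStar)]

/-! ### Proposition 9 (18) at `y = y_c`: `cos(3π/8)·A_T(x_c, y_c) = 1` -/

/-- For `y* < y_T` (strict) the critical weighted bridge class of `S_T` is bounded in `L`: a uniform `K` with `B_{T,L}(x_c,y*) ≤ K`.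
[cite: BeatonBousquetMelouDeGierDuminilCopinGuttmann2014, Corollary 8 (arXiv v5 p. 12: y_T is the radius of convergence; y_{T+1} < y_T, y_T → y_c) with Theorem 2 (p. 3)] -/
theorem exists_stripBy_yStar_le (hT : 1 ≤ T) (h : yStar < stripYT T) :
    ∃ K : ℝ, ∀ L : ℕ, stripGFy T L (IsBetaDart T) yStar ≤ K := by
  obtain ⟨S, rfl⟩ : ∃ S, T = S + 1 := ⟨T - 1, by omega⟩
  have h' : yStar < sSup (stripBddSet (S + 1)) := h
  obtain ⟨y', hy'S, hlt'⟩ := exists_lt_of_lt_csSup (stripBddSet_succ_nonempty S) h'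
  obtain ⟨K, hK⟩ := hy'S.2
  exact ⟨K, fun L => (stripGFy_mono (S + 1) L (IsBetaDart (S + 1)) yStar_pos.le hlt'.le).trans (hK ⟨L, rfl⟩)⟩

/-- ★ **`cos(3π/8) · A_T(x_c, y_c) = 1` for every `T ≥ 1`** — Proposition 9 (18) at `y = y* = y_c` (legitimate because `y_c < y_T`,
the hypothesis `h`): `E_{T,L}(x_c,y_c) → 0` (face Y3′, the bridge class being bounded), `β(y_c) = 0`, and (16) passes to the limit.
Equivalently `A_T(x_c, y_c) = 1/cos(3π/8) = A(x_c)`: the half-plane arch series is attained exactly in every finite strip.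
[cite: BeatonBousquetMelouDeGierDuminilCopinGuttmann2014, Proposition 9 eq. (18) (arXiv v5 p. 14: "For 0 ≤ y < y_T … α A_T(x_c,y) + β(y) B_T(x_c,y) = 1") at y = y* with Theorem 2 (y_c = y* = 1+√2, p. 3) and Corollary 8 (p. 12; its proof, p. 13: "y_T > y_c for all T"); BeatonGuttmannJensen2012Adsorption, §2 eq. (4) (arXiv:1110.6695 p. 4: "1 = cos(3π/8) A_T(x_c, y_c)"; "This is a remarkable equation in that it implies that y_c can be identified from the generating function A_T(x_c, y) for any width T") — a PRINTED corollary (of the BBdGDCG identity, E_T(x_c,y) = 0 for y ≤ y_c, and y_c = y*), consolidated here by a different route (y_c < y_T)] -/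
theorem cos_mul_stripAyLim_yStar_eq_one (hT : 1 ≤ T) (h : yStar < stripYT T) :
    Real.cos (3 * Real.pi / 8) * stripAyLim T yStar = 1 := by
  obtain ⟨K, hK⟩ := exists_stripBy_yStar_le hT h
  have hE := stripELimZeroY_holds T yStar K hT yStar_pos hK
  have hA := tendsto_stripAy_yStar hT
  have hlimit := (hA.const_mul (Real.cos (3 * Real.pi / 8))).add (hE.const_mul (Real.cos (Real.pi / 4)))
  rw [mul_zero, add_zero] at hlimit
  have hconst : Tendsto (fun L : ℕ => Real.cos (3 * Real.pi / 8) * stripGFy T L IsAlphaDart yStar +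
      Real.cos (Real.pi / 4) * stripGFy T L (IsEpsDart L) yStar) atTop (𝓝 1) := by
    refine tendsto_const_nhds.congr fun L => ?_
    have hid := stripIdentityY_holds T L yStar hT yStar_pos
    rw [betaY_yStar_eq_zero, zero_mul, add_zero] at hid
    exact hid.symm
  exact tendsto_nhds_unique hlimit hconst

/-- `A_T(x_c, y_c) = 1/cos(3π/8)` (`T ≥ 1`, `y_c < y_T`) — printed as BGJ12-Ads eq. (4).
[cite: BeatonBousquetMelouDeGierDuminilCopinGuttmann2014, Proposition 9 eq. (18) at y = y* (arXiv v5 p. 14) with Theorem 2 and Corollary 8; BeatonGuttmannJensen2012Adsorption, §2 eq. (4) (arXiv:1110.6695 p. 4: "1 = cos(3π/8) A_T(x_c, y_c)"; "This is a remarkable equation in that it implies that y_c can be identified from the generating function A_T(x_c, y) for any width T") — a PRINTED corollary (of the BBdGDCG identity, E_T(x_c,y) = 0 for y ≤ y_c, and y_c = y*), consolidated here by a different route (y_c < y_T)] -/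
theorem stripAyLim_yStar_eq (hT : 1 ≤ T) (h : yStar < stripYT T) : stripAyLim T yStar = 1 / Real.cos (3 * Real.pi / 8) := by
  have hc : 0 < Real.cos (3 * Real.pi / 8) := cos_three_pi_div_eight_pos
  have h1 := cos_mul_stripAyLim_yStar_eq_one hT h
  field_simp
  linarith

/-- ★ **`A_S(x_c, 1) → A_T(x_c, y_c)` as `S → ∞`, for every fixed `T ≥ 1`** (`y_c < y_T`): the critical surface weight on the far
wall of a strip of ANY width reproduces the half-plane arch series `A(x_c) = lim_S A_S(x_c,1) = 1/cos(3π/8)` (Theorem 10 with (19)).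
[cite: BeatonBousquetMelouDeGierDuminilCopinGuttmann2014, §4.4 Theorem 10 and eq. (19) (arXiv v5 p. 14: "lim_T B_T(x_c,1) = 1 − αA(x_c) … A(x_c) = 1/α") with Proposition 9 (18) at y = y*; lane corollary] -/
theorem tendsto_stripAlim_nhds_stripAyLim_yStar (hT : 1 ≤ T) (h : yStar < stripYT T) :
    Tendsto stripAlim atTop (𝓝 (stripAyLim T yStar)) := by
  rw [stripAyLim_yStar_eq hT h, one_div]
  exact tendsto_stripAlim

/-- ★ **The exact first-order gap at criticality: `A_{T+1}(x_c, y_c) − A_T(x_c, 1) = B_T(x_c, 1)/cos(3π/8)`** (`T ≥ 1`, `y_c < y_{T+1}`),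
from `α A_{T+1}(x_c,y_c) = 1 = α A_T(x_c,1) + B_T(x_c,1)` ((18) at `y_c` and (19)).
[cite: BeatonBousquetMelouDeGierDuminilCopinGuttmann2014, Proposition 9 (18) and eq. (19) (arXiv v5 p. 14), §4.5 first display (p. 15: "αA_{T+1}(x_c,y) + β(y)B_{T+1}(x_c,y) = 1 = αA_T(x_c,1) + B_T(x_c,1)"); explicit gap — lane corollary] -/
theorem stripAyLim_succ_yStar_sub_stripAlim (hT : 1 ≤ T) (h : yStar < stripYT (T + 1)) :
    stripAyLim (T + 1) yStar - stripAlim T = stripBlim T / Real.cos (3 * Real.pi / 8) := by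
  have hc : 0 < Real.cos (3 * Real.pi / 8) := cos_three_pi_div_eight_pos
  have h1 := cos_mul_stripAyLim_yStar_eq_one (T := T + 1) (by omega) h
  have h2 := strip_identity_lim hT
  rw [eq_div_iff hc.ne']
  linarith

/-- `A_T(x_c, 1) < A_{T+1}(x_c, y_c)` with the gap `B_T(x_c,1)/cos(3π/8) > 0`. [cite: BeatonBousquetMelouDeGierDuminilCopinGuttmann2014, Proposition 9 (18), (19) (arXiv v5 p. 14); lane corollary] -/
theorem stripAlim_lt_stripAyLim_succ_yStar (hT : 1 ≤ T) (h : yStar < stripYT (T + 1)) :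
    stripAlim T < stripAyLim (T + 1) yStar := by
  have h1 := stripAyLim_succ_yStar_sub_stripAlim hT h
  have h2 : 0 < stripBlim T / Real.cos (3 * Real.pi / 8) := div_pos (stripBlim_pos hT) cos_three_pi_div_eight_pos
  linarith

/-! ### Below `y_c`: the arch cut in the limit and the quadratic rate -/

/-- `A_T(x_c, 1) ≤ A_{T+1}(x_c, y)` for `0 < y < y*` (arches of height `≤ T` have no top contacts; tree `stripA_le_stripGFy_alpha_succ`
in the limit). [cite: BeatonBousquetMelouDeGierDuminilCopinGuttmann2014, §4.5 (arXiv v5 p. 15: "This includes arches of height at most T, which have no contacts with the top boundary")] -/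
theorem stripAlim_le_stripAyLim_succ (hT : 1 ≤ T) {y : ℝ} (hy : 0 < y) (hlt : y < 1 + Real.sqrt 2) :
    stripAlim T ≤ stripAyLim (T + 1) y := by
  have hA := tendsto_stripAy (T := T + 1) (by omega) hy hlt
  have hA1 := tendsto_stripA DuminilCopinSmirnov2012_lemma2_holds hT
  exact le_of_tendsto_of_tendsto' hA1 hA fun L => stripA_le_stripGFy_alpha_succ T L hy.le

/-- **The arch cut (20) in the limit: `A_{T+1}(x_c,y) − A_T(x_c,1) ≤ x_c · B_T(x_c,1) · B_{T+1}(x_c,y)`** for `0 < y < y*`, `T ≥ 1`.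
[cite: BeatonBousquetMelouDeGierDuminilCopinGuttmann2014, §4.5 eq. (20) (arXiv v5 p. 15: "A_{T+1}(x_c,y) − A_T(x_c,1) ≤ x_c B_T(x_c,1) B_{T+1}(x_c,y)")] -/
theorem stripAyLim_succ_sub_stripAlim_le_mul (hT : 1 ≤ T) {y : ℝ} (hy : 0 < y) (hlt : y < 1 + Real.sqrt 2) :
    stripAyLim (T + 1) y - stripAlim T ≤ hexCriticalFugacity * stripBlim T * stripByLim (T + 1) y := by
  have hA := tendsto_stripAy (T := T + 1) (by omega) hy hlt
  have hA1 := tendsto_stripA DuminilCopinSmirnov2012_lemma2_holds hT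
  have hB := tendsto_stripBy (T := T + 1) (by omega) hy hlt
  have hlim := (hB.const_mul (hexCriticalFugacity * stripBlim T))
  refine le_of_tendsto_of_tendsto' (hA.sub hA1) hlim fun L => ?_
  have hcut := stripArchCut_holds T L y hT hy
  calc stripGFy (T + 1) L IsAlphaDart y - stripA T L hexCriticalFugacity
      ≤ hexCriticalFugacity * stripGFy (T + 1) L (IsBetaDart (T + 1)) y * stripBlim T := hcut
    _ = hexCriticalFugacity * stripBlim T * stripGFy (T + 1) L (IsBetaDart (T + 1)) y := by ring

/-- ★ **Quadratic rate below `y_c`: `|A_{T+1}(x_c,y) − A_T(x_c,1)| ≤ x_c · (√2y/(1+√2−y)) · B_T(x_c,1)²`** for `0 < y < y*`, `T ≥ 1`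
— the limit arch cut with the one-row sandwich `B_{T+1}(x_c,y) ≤ B_T(x_c,1)/β(y)` (tree `stripByLim_succ_le_mul`); one order better
than the tree's `abs_stripAyLim_succ_sub_le` (rate `B_T`).  [cite: BeatonBousquetMelouDeGierDuminilCopinGuttmann2014, §4.5 (20) (arXiv v5 p. 15) and §4.4 Remark 1 (p. 14); second-order rate — lane corollary, not in print] -/
theorem abs_stripAyLim_succ_sub_stripAlim_le_sq (hT : 1 ≤ T) {y : ℝ} (hy : 0 < y) (hlt : y < 1 + Real.sqrt 2) :
    |stripAyLim (T + 1) y - stripAlim T| ≤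
      hexCriticalFugacity * (Real.sqrt 2 * y / (1 + Real.sqrt 2 - y)) * stripBlim T ^ 2 := by
  rw [abs_of_nonneg (sub_nonneg.2 (stripAlim_le_stripAyLim_succ hT hy hlt))]
  have h1 := stripAyLim_succ_sub_stripAlim_le_mul hT hy hlt
  have h2 := stripByLim_succ_le_mul hT hy hlt
  have hx : 0 < hexCriticalFugacity := hexCriticalFugacity_pos_lt_one.1
  have hB := stripBlim_pos hT
  calc stripAyLim (T + 1) y - stripAlim T ≤ hexCriticalFugacity * stripBlim T * stripByLim (T + 1) y := h1
    _ ≤ hexCriticalFugacity * stripBlim T * (Real.sqrt 2 * y / (1 + Real.sqrt 2 - y) * stripBlim T) :=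
        mul_le_mul_of_nonneg_left h2 (mul_pos hx hB).le
    _ = hexCriticalFugacity * (Real.sqrt 2 * y / (1 + Real.sqrt 2 - y)) * stripBlim T ^ 2 := by ring

/-- With Glazman–Manolescu: `|A_{T+1}(x_c,y) − A_T(x_c,1)| ≤ x_c · (√2y/(1+√2−y)) · 25 (ln T)^{−2/3}` (`T ≥ 2`, `0 < y < y*`).
[cite: GlazmanManolescu2019, Proposition 1.1 (tree `hexBridgeLogDecay`: B_T(x_c) ≤ 5 (ln T)^{-1/3}); BeatonBousquetMelouDeGierDuminilCopinGuttmann2014, §4.5 (20) (arXiv v5 p. 15); lane composite, not in print] -/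
theorem abs_stripAyLim_succ_sub_stripAlim_le_log_sq (hT : 2 ≤ T) {y : ℝ} (hy : 0 < y) (hlt : y < 1 + Real.sqrt 2) :
    |stripAyLim (T + 1) y - stripAlim T| ≤
      hexCriticalFugacity * (Real.sqrt 2 * y / (1 + Real.sqrt 2 - y)) * (25 * (Real.log T ^ (-(1 : ℝ) / 3)) ^ 2) := by
  have h := abs_stripAyLim_succ_sub_stripAlim_le_sq (T := T) (by omega) hy hlt
  have hB : stripBlim T ≤ 5 * Real.log T ^ (-(1 : ℝ) / 3) := hexBridgeLogDecay T hT
  have hB0 : 0 ≤ stripBlim T := (stripBlim_pos (T := T) (by omega)).le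
  have hsq : stripBlim T ^ 2 ≤ 25 * (Real.log T ^ (-(1 : ℝ) / 3)) ^ 2 := by nlinarith
  have hc : 0 ≤ hexCriticalFugacity * (Real.sqrt 2 * y / (1 + Real.sqrt 2 - y)) :=
    mul_nonneg hexCriticalFugacity_pos_lt_one.1.le (div_nonneg (by positivity) (by linarith))
  exact h.trans (mul_le_mul_of_nonneg_left hsq hc)

/-- The contrast, packaged: at `y_c` the gap to `A_T(x_c,1)` is EXACTLY `B_T/α` (first order), below `y_c` it is `O(B_T²)`:
for `0 < y < y*`, `T ≥ 1`, `y_c < y_{T+1}`:  `(A_{T+1}(x_c,y) − A_T(x_c,1)) · cos(3π/8) ≤ x_c(√2y/(1+√2−y))·B_T · (A_{T+1}(x_c,y_c) − A_T(x_c,1))`.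
[cite: BeatonBousquetMelouDeGierDuminilCopinGuttmann2014, §4.4–4.5 (arXiv v5 pp. 14–15); lane corollary, not in print] -/
theorem sub_stripAlim_mul_cos_le (hT : 1 ≤ T) (h : yStar < stripYT (T + 1)) {y : ℝ} (hy : 0 < y) (hlt : y < 1 + Real.sqrt 2) :
    (stripAyLim (T + 1) y - stripAlim T) * Real.cos (3 * Real.pi / 8) ≤
      hexCriticalFugacity * (Real.sqrt 2 * y / (1 + Real.sqrt 2 - y)) * stripBlim T *
        (stripAyLim (T + 1) yStar - stripAlim T) := by
  rw [stripAyLim_succ_yStar_sub_stripAlim hT h]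
  have hc : 0 < Real.cos (3 * Real.pi / 8) := cos_three_pi_div_eight_pos
  have h1 := abs_stripAyLim_succ_sub_stripAlim_le_sq hT hy hlt
  rw [abs_of_nonneg (sub_nonneg.2 (stripAlim_le_stripAyLim_succ hT hy hlt))] at h1
  have h2 := mul_le_mul_of_nonneg_right h1 hc.le
  calc (stripAyLim (T + 1) y - stripAlim T) * Real.cos (3 * Real.pi / 8)
      ≤ hexCriticalFugacity * (Real.sqrt 2 * y / (1 + Real.sqrt 2 - y)) * stripBlim T ^ 2 * Real.cos (3 * Real.pi / 8) := h2
    _ = hexCriticalFugacity * (Real.sqrt 2 * y / (1 + Real.sqrt 2 - y)) * stripBlim T *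
        (stripBlim T / Real.cos (3 * Real.pi / 8)) * Real.cos (3 * Real.pi / 8) ^ 2 := by
          field_simp
    _ ≤ hexCriticalFugacity * (Real.sqrt 2 * y / (1 + Real.sqrt 2 - y)) * stripBlim T *
        (stripBlim T / Real.cos (3 * Real.pi / 8)) := by
          have hcos1 : Real.cos (3 * Real.pi / 8) ^ 2 ≤ 1 := by
            have := Real.abs_cos_le_one (3 * Real.pi / 8)
            rw [abs_le] at this
            nlinarith
          have hpos : 0 ≤ hexCriticalFugacity * (Real.sqrt 2 * y / (1 + Real.sqrt 2 - y)) * stripBlim T *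
              (stripBlim T / Real.cos (3 * Real.pi / 8)) := by
            have hx : 0 < hexCriticalFugacity := hexCriticalFugacity_pos_lt_one.1
            have hB := stripBlim_pos hT
            have : 0 < Real.sqrt 2 * y / (1 + Real.sqrt 2 - y) := div_pos (by positivity) (by linarith)
            positivity
          exact mul_le_of_le_one_right hpos hcos1

end Literature.Probability.RandomPlanarGeometry.SAW.HV

end
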